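import Summits.MatrixMultiplication.MatrixMultiplication.Theorems.EdgePencilFlatSummandProfile
import HarnessLib

/-!
# The flat-summand purchase at ONE base: tropical domination of the doubled-edge diamond
# `W_n^{(2)}` by `{D_n, ⟨n⁴⟩}` on the 4-party spectrum is EQUIVALENT to the purchase along the powers
# of `n`, and already proves the rung

Support kernel for `stmt-MatrixMultiplication-26697` (`TetraExcessZero`, route `TetrahedronCarving`; cut of
record `closes (TetraExcessZero) (TetraPlusTwo) : ω = 2`, UNCHANGED; lineage `decomp-mm-lens-6`, generation 43).
No item is added or changed; no definition is introduced. Notation as in `EdgePencilFlatSummandProfile`: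
`W_n^{(e)} = sixTetra F n e`, `D_n = W_n^{(1)}`, `T₄(F) = DTensorClass F 4`, `X₄(F) =
DTensorClass.asymptoticSpectrumDTensors F 2`, `[t] = DTensorClass.mk t`, `≲ = AsympLe (· ≤ ·)`, the purchase of
record `RUNG♭(δ, N) : [W_N^{(⌈N^δ⌉)}] ≲ [D_N] + N⁴`, `χ(δ) = omegaSix F δ`, `ψ = omegaRect F 2 1 2`.

THE FIXED-BASE FORM (spelled out in every statement, no `def`):

  `TROP(n, e) :⟺ ∀ φ ∈ X₄(F), φ[W_n^{(e)}] ≤ max (φ[D_n], n⁴)`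

— ONE finite pair of tensors (`W_n^{(e)}`, `D_n`) and one number; in words: every 4-party spectral point is
BLIND to the thickened edge (`φ[W_n^{(e)}] = φ[D_n]`) or values the thickened tensor at most the flattening
bound `n⁴` (`trop_iff_blind_or_le`).

§11 BASICS. Level monotonicity as a CLASS inequality `[W_m^{(e)}] ≤ [W_{m'}^{(e)}]` (`m ≤ m'`,
`mk_sixTetra_mono_level`; the tree had the rank form `tensorRankD_sixTetra_mono_level`); `TROP` is antitone in
`e` and PROPAGATES TO POWERS: `TROP(n, e) ⟹ TROP(n^{k+1}, e^{k+1})` (`trop_pow`, multiplicativity of points).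

§12 DUALITY AT ONE BASE (`trop_iff_purchase_pow`, `2 ≤ n`, `1 ≤ e ≤ n`):

  `TROP(n, e) ⟺ ∀ k, [W_{n^{k+1}}^{(e^{k+1})}] ≲ [D_{n^{k+1}}] + n^{4(k+1)}`
  `          ⟺ the same at infinitely many k`                         (`trop_of_purchase_pow`).

(`⟹`: Strassen's spectral characterisation `asympLe_iff_forall_mem_spectrum` and `max^{k+1} ≤ sum`;
`⟸`: a violating point has ratio `w / max > 1`, whose powers beat the factor `2` — the Bernoulli argument of
`EdgePencilFlatSummandProfile.blind_or_flat`, here in its sharp form.) So along the powers of one base the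
purchase of record is NOT an infinite family of asymptotic statements but ONE inequality on `X₄` for ONE pair.

§13 THE RUNG FROM ONE BASE. `⌈(n^{k+1})^{log_n e}⌉ = e^{k+1}` (`rectDim_pow_logb`), hence
`TROP(n, e) ⟹ RUNG♭(log_n e, n^{k+1}) ∀ k ⟹ χ(log_n e) ≤ ψ` (`sixRung_of_trop`, through the landed price
theorem `EdgePencilFlatSummandPrice.sixRung_of_flatPurchase`), and BY NAME over `ℂ`:

  `sixRungPos_of_trop : (∃ n ≥ 2, TROP_ℂ(n, 2)) → ∃ δ : ℝ, 0 < δ ∧ omegaSix ℂ δ ≤ omegaRect ℂ 2 1 2`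

(conclusion = `stub_sixRungPos` of the registered line `rung_and_chord`, with `δ = log_n 2`). The smallest
in-window instances: `n = 3` (`δ = log₃2 ≈ 0.63`), `n = 4` (`δ = ½`, the line's `δ`): the upper-side search of
record is now «a degeneration `(D_4 ⊕ ⟨256⟩)^{⊠k} ⊵ 2^{−o(k)}·(W_4^{(2)})^{⊠k}`», one pair of fixed tensors of
formats `(32, 32, 64, 64)` and `(16, 16, 64, 64)`; and the family weakens along powers (`TROP(n,2) ⟹
TROP(n^{k+1}, 2)`), so ANY base suffices and larger bases are easier.

§14 NEC (`trop_of_matrixMultiplication`): `ω = 2 ⟹ TROP_ℂ(n, e)` for all `2 ≤ n`, `1 ≤ e ≤ n`.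
§15 THE KILL TEST, SHARP AT ONE BASE (`not_purchase_pow_of_separating_point`): one `φ ∈ X₄(F)` with
`max (φ[D_n], n⁴) < φ[W_n^{(e)}]` refutes the purchase along the powers of `n` — and by §12 this test is
COMPLETE for the power family (`exists_separating_point_of_not_trop`): no other obstruction exists.

References: Strassen 1988 (asymptotic spectrum; spectral characterisation of `≲`) [Strassen1988]; Zuiddam 2018,
Thm. 2.12, Cor. 2.13 [Zuiddam2018]; Christandl–Vrana–Zuiddam 2023, Thm. 1.1 [ChristandlVranaZuiddam2023];
Christandl–Vrana–Zuiddam, arXiv:1609.07476, §1.1 [ChristandlVranaZuiddam2016].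
No `sorry`, no new axiom, no instance, no notation, no definition.
-/

noncomputable section

set_option linter.dupNamespace false

open Finset Literature.Computability.AlgebraicComplexity
open Summit.MatrixMultiplication.MatrixMultiplication.Theorems.TetrahedronTensor
open Summit.MatrixMultiplication.MatrixMultiplication.Theorems.TetraDiagonal
open Summit.MatrixMultiplication.MatrixMultiplication.Theses.TetrahedronCarving

namespace Summit.MatrixMultiplication.MatrixMultiplication.Theorems.EdgePencil

/-! ## §11 Basics: level monotonicity in `T₄(F)`, antitonicity and powers of `TROP` -/

section Basics

variable {F : Type*} [Field F]

/-- **Monotonicity in the level, as a class inequality**: `[W_m^{(e)}] ≤ [W_{m'}^{(e)}]` for `m ≤ m'`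
(`W_m^{(e)}` is a leg-wise pullback of `W_{m'}^{(e)}`, `sixTetra_eq_pullback_level`). [folklore] -/
theorem mk_sixTetra_mono_level {m m' : ℕ} (h : m ≤ m') (e : ℕ) :
    DTensorClass.mk (sixTetra F m e) ≤ DTensorClass.mk (sixTetra F m' e) := by
  rw [sixTetra_eq_pullback_level (F := F) h e, DTensorClass.mk_le_mk_iff]
  exact DTensor.restricts_precomp
    (fun x : Fin (m ^ 3) => (finFunctionFinEquiv
      (fun j => Fin.castLE h (finFunctionFinEquiv.symm x j)) : Fin (m' ^ 3))) (sixTetra F m' e)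

/-- For reals `a ≤ w`: `w ≤ max a b ↔ (w = a ∨ w ≤ b)` — `TROP` at a point is «blind or below the bound».
[folklore] -/
theorem le_max_iff_eq_or_le {a b w : ℝ} (haw : a ≤ w) : w ≤ max a b ↔ (w = a ∨ w ≤ b) := by
  constructor
  · intro h
    rcases le_max_iff.1 h with h1 | h2
    · exact Or.inl (le_antisymm h1 haw)
    · exact Or.inr h2
  · rintro (h | h)
    · exact h ▸ le_max_left _ _
    · exact le_max_of_le_right h

/-- **`TROP(n,e)` at a point ⟺ blind or below the flattening bound** (`1 ≤ e`). [cite: Zuiddam2018, Def. 2.11] -/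
theorem trop_iff_blind_or_le {n e : ℕ} (he : 1 ≤ e) {φ : DTensorClass F 4 → ℝ}
    (hφ : φ ∈ DTensorClass.asymptoticSpectrumDTensors F 2) :
    φ (DTensorClass.mk (sixTetra F n e)) ≤ max (φ (DTensorClass.mk (sixTetra F n 1))) ((n : ℝ) ^ 4) ↔
      (φ (DTensorClass.mk (sixTetra F n e)) = φ (DTensorClass.mk (sixTetra F n 1)) ∨
        φ (DTensorClass.mk (sixTetra F n e)) ≤ (n : ℝ) ^ 4) :=
  le_max_iff_eq_or_le (spectrum_diamond_le_sixTetra (F := F) he hφ)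

/-- **`TROP` is antitone in the thickness**: `TROP(n, e') ⟹ TROP(n, e)` for `e ≤ e'`.
[cite: Zuiddam2018, Def. 2.11] -/
theorem trop_anti {n e e' : ℕ} (hee' : e ≤ e')
    (hT : ∀ φ ∈ DTensorClass.asymptoticSpectrumDTensors F 2,
      φ (DTensorClass.mk (sixTetra F n e')) ≤ max (φ (DTensorClass.mk (sixTetra F n 1))) ((n : ℝ) ^ 4)) :
    ∀ φ ∈ DTensorClass.asymptoticSpectrumDTensors F 2,
      φ (DTensorClass.mk (sixTetra F n e)) ≤ max (φ (DTensorClass.mk (sixTetra F n 1))) ((n : ℝ) ^ 4) :=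
  fun φ hφ => ((DTensorClass.mem_asymptoticSpectrumDTensors_iff.1 hφ).mono (mk_sixTetra_mono hee')).trans
    (hT φ hφ)

/-- **`TROP` propagates to powers**: `TROP(n, e) ⟹ TROP(n^{k+1}, e^{k+1})` (`e ≤ n`, `1 ≤ n`).
[cite: ChristandlVranaZuiddam2023, §1.2] -/
theorem trop_pow {n e : ℕ} (hn : 1 ≤ n) (he : e ≤ n)
    (hT : ∀ φ ∈ DTensorClass.asymptoticSpectrumDTensors F 2,
      φ (DTensorClass.mk (sixTetra F n e)) ≤ max (φ (DTensorClass.mk (sixTetra F n 1))) ((n : ℝ) ^ 4))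
    (k : ℕ) :
    ∀ φ ∈ DTensorClass.asymptoticSpectrumDTensors F 2,
      φ (DTensorClass.mk (sixTetra F (n ^ (k + 1)) (e ^ (k + 1)))) ≤
        max (φ (DTensorClass.mk (sixTetra F (n ^ (k + 1)) 1))) (((n ^ (k + 1) : ℕ) : ℝ) ^ 4) := by
  intro φ hφ
  have hφ' := DTensorClass.mem_asymptoticSpectrumDTensors_iff.1 hφ
  have hSP : IsStrassenPreorder (fun x y : DTensorClass F 4 => x ≤ y) :=
    DTensorClass.isStrassenPreorder F 2
  have hD : φ (DTensorClass.mk (sixTetra F (n ^ (k + 1)) 1)) =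
      φ (DTensorClass.mk (sixTetra F n 1)) ^ (k + 1) := by
    have := spectrum_sixTetra_pow (F := F) hn k hφ
    rw [one_pow] at this
    exact this.symm
  rw [← spectrum_sixTetra_pow (F := F) he k hφ, hD]
  have h0 : 0 ≤ φ (DTensorClass.mk (sixTetra F n e)) := hφ'.nonneg hSP _
  have hle := hT φ hφ
  have hcast : (((n ^ (k + 1) : ℕ) : ℝ)) ^ 4 = ((n : ℝ) ^ 4) ^ (k + 1) := by push_cast; ring
  rw [hcast]
  rcases le_total (φ (DTensorClass.mk (sixTetra F n 1))) ((n : ℝ) ^ 4) with hab | hba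
  · rw [max_eq_right hab] at hle
    exact le_max_of_le_right (pow_le_pow_left₀ h0 hle _)
  · rw [max_eq_left hba] at hle
    exact le_max_of_le_left (pow_le_pow_left₀ h0 hle _)

end Basics

/-! ## §12 Duality at one base -/

section Duality

variable {F : Type*} [Field F]

/-- **`TROP(n,e)` ⟹ the purchase at every power level** (Strassen's spectral characterisation, and
`max (a,b)^{k+1} ≤ a^{k+1} + b^{k+1}`). [cite: Strassen1988, Thm. (spectral characterisation)] -/
theorem purchase_pow_of_trop {n e : ℕ} (hn : 1 ≤ n) (he : e ≤ n)
    (hT : ∀ φ ∈ DTensorClass.asymptoticSpectrumDTensors F 2,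
      φ (DTensorClass.mk (sixTetra F n e)) ≤ max (φ (DTensorClass.mk (sixTetra F n 1))) ((n : ℝ) ^ 4))
    (k : ℕ) :
    AsympLe (fun x y : DTensorClass F 4 => x ≤ y)
      (DTensorClass.mk (sixTetra F (n ^ (k + 1)) (e ^ (k + 1))))
      (DTensorClass.mk (sixTetra F (n ^ (k + 1)) 1) + (((n ^ (k + 1)) ^ 4 : ℕ) : DTensorClass F 4)) := by
  have hSP : IsStrassenPreorder (fun x y : DTensorClass F 4 => x ≤ y) :=
    DTensorClass.isStrassenPreorder F 2
  refine DTensorClass.asympLe_iff_forall_mem_spectrum.2 fun φ hφ => ?_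
  have hφ' := DTensorClass.mem_asymptoticSpectrumDTensors_iff.1 hφ
  rw [hφ'.map_add, hφ'.map_natCast]
  have h := trop_pow (F := F) hn he hT k φ hφ
  have hDnn : 0 ≤ φ (DTensorClass.mk (sixTetra F (n ^ (k + 1)) 1)) := hφ'.nonneg hSP _
  have hcast : (((n ^ (k + 1)) ^ 4 : ℕ) : ℝ) = (((n ^ (k + 1) : ℕ) : ℝ)) ^ 4 := by push_cast; ring
  rw [hcast]
  refine h.trans (max_le ?_ ?_)
  · linarith [pow_nonneg (Nat.cast_nonneg (n ^ (k + 1)) : (0 : ℝ) ≤ ((n ^ (k + 1) : ℕ) : ℝ)) 4]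
  · linarith

/-- **The purchase at infinitely many power levels ⟹ `TROP(n,e)`** (sharp form of `blind_or_flat`): a
violating point has `w > M = max (φ[D_n], n⁴) ≥ 1`, ratio `1 + η = w/M > 1`, and `(1+η)^{k+1} ≤ 2` at the
purchased levels is impossible for `(k+1)η > 1`. [cite: Zuiddam2018, Thm. 2.12] -/
theorem trop_of_purchase_pow {n e : ℕ} (hn : 2 ≤ n) (he : e ≤ n)
    (h : ∀ k₀ : ℕ, ∃ k : ℕ, k₀ ≤ k ∧
      AsympLe (fun x y : DTensorClass F 4 => x ≤ y)
        (DTensorClass.mk (sixTetra F (n ^ (k + 1)) (e ^ (k + 1))))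
        (DTensorClass.mk (sixTetra F (n ^ (k + 1)) 1) + (((n ^ (k + 1)) ^ 4 : ℕ) : DTensorClass F 4))) :
    ∀ φ ∈ DTensorClass.asymptoticSpectrumDTensors F 2,
      φ (DTensorClass.mk (sixTetra F n e)) ≤ max (φ (DTensorClass.mk (sixTetra F n 1))) ((n : ℝ) ^ 4) := by
  intro φ hφ
  have hn1 : 1 ≤ n := by omega
  have hφ' := DTensorClass.mem_asymptoticSpectrumDTensors_iff.1 hφ
  set a := φ (DTensorClass.mk (sixTetra F n 1)) with ha
  set w := φ (DTensorClass.mk (sixTetra F n e)) with hw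
  set M := max a ((n : ℝ) ^ 4) with hM
  by_contra hlt
  rw [not_le] at hlt
  have ha1 : 1 ≤ a := one_le_spectrum_sixTetra (F := F) hn1 le_rfl hφ
  have hM1 : 1 ≤ M := ha1.trans (le_max_left _ _)
  have hM0 : 0 < M := by linarith
  set η : ℝ := w / M - 1 with hη
  have hη0 : 0 < η := by
    rw [hη, sub_pos, one_lt_div hM0]
    exact hlt
  have hwr : w = (1 + η) * M := by
    rw [hη]
    field_simp
    ring
  obtain ⟨k, hk, hP⟩ := h ⌈1 / η⌉₊
  have hkη : 1 < (k + 1 : ℝ) * η := by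
    have h1 : 1 / η ≤ (⌈1 / η⌉₊ : ℝ) := Nat.le_ceil _
    have h2 : (⌈1 / η⌉₊ : ℝ) ≤ k := by exact_mod_cast hk
    have h3 : 1 / η * η = 1 := by field_simp
    nlinarith
  have hpow : 2 < (1 + η) ^ (k + 1) := by
    have hb := one_add_mul_le_pow (by linarith : (-2 : ℝ) ≤ η) (k + 1)
    push_cast at hb
    linarith
  -- the purchase at level `n^{k+1}`, read at `φ`
  have key := (DTensorClass.asympLe_iff_forall_mem_spectrum.1 hP) φ hφ
  rw [hφ'.map_add, hφ'.map_natCast, ← spectrum_sixTetra_pow (F := F) he k hφ, ← hw] at key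
  have hDpow : φ (DTensorClass.mk (sixTetra F (n ^ (k + 1)) 1)) = a ^ (k + 1) := by
    have := spectrum_sixTetra_pow (F := F) hn1 k hφ
    rw [one_pow] at this
    rw [← this]
  have hcast : (((n ^ (k + 1)) ^ 4 : ℕ) : ℝ) = ((n : ℝ) ^ 4) ^ (k + 1) := by push_cast; ring
  rw [hDpow, hcast] at key
  -- both summands are at most `M^{k+1}`
  have ha0 : 0 ≤ a := by linarith
  have hb0 : (0 : ℝ) ≤ (n : ℝ) ^ 4 := by positivity
  have h1 : a ^ (k + 1) ≤ M ^ (k + 1) := pow_le_pow_left₀ ha0 (le_max_left _ _) _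
  have h2 : ((n : ℝ) ^ 4) ^ (k + 1) ≤ M ^ (k + 1) := pow_le_pow_left₀ hb0 (le_max_right _ _) _
  have hMpos : 0 < M ^ (k + 1) := pow_pos hM0 _
  rw [hwr, mul_pow] at key
  have : (1 + η) ^ (k + 1) ≤ 2 := le_of_mul_le_mul_right (by linarith) hMpos
  linarith

/-- **DUALITY AT ONE BASE**: `TROP(n, e) ⟺` the purchase `[W_{n^{k+1}}^{(e^{k+1})}] ≲ [D_{n^{k+1}}] + n^{4(k+1)}`
at every `k` (`2 ≤ n`, `e ≤ n`). [cite: Strassen1988, Thm. (spectral characterisation)] -/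
theorem trop_iff_purchase_pow {n e : ℕ} (hn : 2 ≤ n) (he : e ≤ n) :
    (∀ φ ∈ DTensorClass.asymptoticSpectrumDTensors F 2,
      φ (DTensorClass.mk (sixTetra F n e)) ≤ max (φ (DTensorClass.mk (sixTetra F n 1))) ((n : ℝ) ^ 4)) ↔
    ∀ k : ℕ, AsympLe (fun x y : DTensorClass F 4 => x ≤ y)
      (DTensorClass.mk (sixTetra F (n ^ (k + 1)) (e ^ (k + 1))))
      (DTensorClass.mk (sixTetra F (n ^ (k + 1)) 1) + (((n ^ (k + 1)) ^ 4 : ℕ) : DTensorClass F 4)) :=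
  ⟨fun hT k => purchase_pow_of_trop (by omega) he hT k,
    fun h => trop_of_purchase_pow hn he fun k₀ => ⟨k₀, le_rfl, h k₀⟩⟩

end Duality

/-! ## §13 The rung from one base -/

section Rung

variable (F : Type) [Field F]

/-- `⌈(n^{k+1})^{log_n e}⌉ = e^{k+1}` (`2 ≤ n`, `1 ≤ e`). [folklore] -/
theorem rectDim_pow_logb {n e : ℕ} (hn : 2 ≤ n) (he : 1 ≤ e) (k : ℕ) :
    rectDim (n ^ (k + 1)) (Real.logb n e) = e ^ (k + 1) := by
  have hn0 : (0 : ℝ) < n := by exact_mod_cast (show 0 < n by omega)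
  have hn1 : (n : ℝ) ≠ 1 := by exact_mod_cast (show n ≠ 1 by omega)
  have he0 : (0 : ℝ) < e := by exact_mod_cast he
  unfold rectDim
  have : (((n ^ (k + 1) : ℕ) : ℝ)) ^ Real.logb n e = ((e ^ (k + 1) : ℕ) : ℝ) := by
    push_cast
    rw [← Real.rpow_natCast (n : ℝ) (k + 1), ← Real.rpow_mul hn0.le, mul_comm, Real.rpow_mul hn0.le,
      Real.rpow_logb hn0 hn1 he0, Real.rpow_natCast]
  rw [this, Nat.ceil_natCast]

/-- **`TROP(n, e) ⟹ χ(log_n e) ≤ ψ`** (`2 ≤ e ≤ n`): the purchase of record `RUNG♭(log_n e, ·)` holds at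
every power of `n` (`purchase_pow_of_trop`, `rectDim_pow_logb`), and the landed price theorem
`sixRung_of_flatPurchase` applies. [cite: ChristandlVranaZuiddam2016, §1.1] -/
theorem sixRung_of_trop {n e : ℕ} (hn : 2 ≤ n) (he2 : 1 ≤ e) (he : e ≤ n)
    (hT : ∀ φ ∈ DTensorClass.asymptoticSpectrumDTensors F 2,
      φ (DTensorClass.mk (sixTetra F n e)) ≤ max (φ (DTensorClass.mk (sixTetra F n 1))) ((n : ℝ) ^ 4)) :
    omegaSix F (Real.logb n e) ≤ omegaRect F 2 1 2 := by
  have hn1' : (1 : ℝ) < n := by exact_mod_cast (show 1 < n by omega)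
  have hδ0 : 0 ≤ Real.logb n e := Real.logb_nonneg hn1' (by exact_mod_cast he2)
  have hδ1 : Real.logb n e ≤ 1 := by
    rw [← Real.logb_self_eq_one hn1']
    exact Real.logb_le_logb_of_le hn1' (by exact_mod_cast he2) (by exact_mod_cast he)
  refine sixRung_of_flatPurchase F hδ0 hδ1 fun n₀ => ⟨n ^ (n₀ + 1), ?_, ?_⟩
  · have h1 : n₀ + 1 ≤ 2 ^ (n₀ + 1) := (Nat.lt_two_pow_self).le
    have h2 : 2 ^ (n₀ + 1) ≤ n ^ (n₀ + 1) := Nat.pow_le_pow_left hn _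
    omega
  · rw [rectDim_pow_logb hn he2 n₀]
    exact purchase_pow_of_trop (by omega) he hT n₀

/-- **`stub_sixRungPos` FROM ONE BASE, BY NAME**: if at some base `n ≥ 2` every 4-party spectral point values
the doubled-edge diamond `W_n^{(2)}` at most `max (φ[D_n], n⁴)`, then `∃ δ > 0, χ(δ) ≤ ψ` over `ℂ`
(`δ = log_n 2`). [cite: ChristandlVranaZuiddam2016, §1.1] -/
theorem sixRungPos_of_trop
    (h : ∃ n : ℕ, 2 ≤ n ∧ ∀ φ ∈ DTensorClass.asymptoticSpectrumDTensors ℂ 2,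
      φ (DTensorClass.mk (sixTetra ℂ n 2)) ≤ max (φ (DTensorClass.mk (sixTetra ℂ n 1))) ((n : ℝ) ^ 4)) :
    ∃ δ : ℝ, 0 < δ ∧ omegaSix ℂ δ ≤ omegaRect ℂ 2 1 2 := by
  obtain ⟨n, hn, hT⟩ := h
  have hn1' : (1 : ℝ) < n := by exact_mod_cast (show 1 < n by omega)
  exact ⟨Real.logb n 2, Real.logb_pos hn1' (by norm_num), sixRung_of_trop ℂ hn (by norm_num) hn hT⟩

end Rung

/-! ## §14 NEC: under `ω = 2` every base is tropically dominated -/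

section Nec

/-- **NEC**: `ω = 2 ⟹ TROP_ℂ(n, e)` for `2 ≤ n`, `e ≤ n` (the purchase of record at `δ = 1` along all
levels, `flatPurchase_of_matrixMultiplication`, thinned to `e^{k+1} ≤ n^{k+1}`, then `trop_of_purchase_pow`).
[cite: ChristandlVranaZuiddam2016, §1.1] -/
theorem trop_of_matrixMultiplication (hS : _root_.MatrixMultiplication) {n e : ℕ} (hn : 2 ≤ n)
    (he : e ≤ n) :
    ∀ φ ∈ DTensorClass.asymptoticSpectrumDTensors ℂ 2,
      φ (DTensorClass.mk (sixTetra ℂ n e)) ≤ max (φ (DTensorClass.mk (sixTetra ℂ n 1))) ((n : ℝ) ^ 4) := by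
  have hSP : IsStrassenPreorder (fun x y : DTensorClass ℂ 4 => x ≤ y) :=
    DTensorClass.isStrassenPreorder ℂ 2
  refine trop_of_purchase_pow hn he fun k₀ => ⟨k₀, le_rfl, ?_⟩
  have hN : 2 ≤ n ^ (k₀ + 1) := le_trans hn (Nat.le_self_pow (Nat.succ_ne_zero k₀) n)
  have hP := flatPurchase_of_matrixMultiplication hS le_rfl hN
  rw [rectDim_one] at hP
  exact hSP.asympLe_trans (hSP.asympLe_of_le (mk_sixTetra_mono (Nat.pow_le_pow_left he _))) hP

end Nec

/-! ## §15 The kill test at one base: sharp and complete -/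

section Kill

variable {F : Type*} [Field F]

/-- **KILL TEST, SHARP**: one point `φ ∈ X₄(F)` with `max (φ[D_n], n⁴) < φ[W_n^{(e)}]` refutes the purchase
`[W_{n^{k+1}}^{(e^{k+1})}] ≲ [D_{n^{k+1}}] + n^{4(k+1)}` at all large `k` (`2 ≤ n`, `e ≤ n`).
[cite: Zuiddam2018, Thm. 2.12] -/
theorem not_purchase_pow_of_separating_point {n e : ℕ} (hn : 2 ≤ n) (he : e ≤ n)
    {φ : DTensorClass F 4 → ℝ} (hφ : φ ∈ DTensorClass.asymptoticSpectrumDTensors F 2)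
    (hsep : max (φ (DTensorClass.mk (sixTetra F n 1))) ((n : ℝ) ^ 4) < φ (DTensorClass.mk (sixTetra F n e))) :
    ¬ ∀ k₀ : ℕ, ∃ k : ℕ, k₀ ≤ k ∧
      AsympLe (fun x y : DTensorClass F 4 => x ≤ y)
        (DTensorClass.mk (sixTetra F (n ^ (k + 1)) (e ^ (k + 1))))
        (DTensorClass.mk (sixTetra F (n ^ (k + 1)) 1) + (((n ^ (k + 1)) ^ 4 : ℕ) : DTensorClass F 4)) :=
  fun h => absurd (trop_of_purchase_pow hn he h φ hφ) (not_le.mpr hsep)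

/-- **KILL TEST, COMPLETE**: if `TROP(n, e)` fails then a separating point EXISTS — no other obstruction to
the purchase along the powers of `n` is possible. [cite: Strassen1988, Thm. (spectral characterisation)] -/
theorem exists_separating_point_of_not_trop {n e : ℕ}
    (h : ¬ ∀ φ ∈ DTensorClass.asymptoticSpectrumDTensors F 2,
      φ (DTensorClass.mk (sixTetra F n e)) ≤ max (φ (DTensorClass.mk (sixTetra F n 1))) ((n : ℝ) ^ 4)) :
    ∃ φ ∈ DTensorClass.asymptoticSpectrumDTensors F 2,
      max (φ (DTensorClass.mk (sixTetra F n 1))) ((n : ℝ) ^ 4) < φ (DTensorClass.mk (sixTetra F n e)) := by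
  by_contra hne
  refine h fun φ hφ => ?_
  by_contra hlt
  exact hne ⟨φ, hφ, not_le.mp hlt⟩

/-- **The purchase along the powers of `n` fails ⟺ a separating point exists** (`2 ≤ n`, `e ≤ n`).
[cite: Strassen1988, Thm. (spectral characterisation)] -/
theorem not_purchase_pow_iff_exists_separating_point {n e : ℕ} (hn : 2 ≤ n) (he : e ≤ n) :
    (¬ ∀ k : ℕ, AsympLe (fun x y : DTensorClass F 4 => x ≤ y)
      (DTensorClass.mk (sixTetra F (n ^ (k + 1)) (e ^ (k + 1))))
      (DTensorClass.mk (sixTetra F (n ^ (k + 1)) 1) + (((n ^ (k + 1)) ^ 4 : ℕ) : DTensorClass F 4))) ↔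
    ∃ φ ∈ DTensorClass.asymptoticSpectrumDTensors F 2,
      max (φ (DTensorClass.mk (sixTetra F n 1))) ((n : ℝ) ^ 4) < φ (DTensorClass.mk (sixTetra F n e)) := by
  rw [← trop_iff_purchase_pow hn he]
  refine ⟨exists_separating_point_of_not_trop, ?_⟩
  rintro ⟨φ, hφ, hsep⟩ hT
  exact absurd (hT φ hφ) (not_le.mpr hsep)

end Kill

end Summit.MatrixMultiplication.MatrixMultiplication.Theorems.EdgePencil

end
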